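import Summits.Ventures.CertifiedManyBodySolver.Observables.PairLROTowerChargedTwist
import Summits.Ventures.CertifiedManyBodySolver.Observables.PairLROTowerChargedLeaf
import HarnessLib

/-!
# OP1-C, part 10: the TWISTED orbit-state form of the grid theorem and its leaf consumer

HONEST FRAMING: first certified bounds on pairing observables; not a superconductivity verdict; a ceiling route,
never presence; nothing in this file is a number. Crew hubbard-obs (D-0042), seat hubbard-obs-p1
(`prover-hubbard-obs-p1-g9-0`); lead RULINGS (eo) d181 / (ex) d190. Zero compute; no definition; no named fact;
no `sorry`.

An OP1-C claim node exported under the TWISTED identification (eng-2's j248069 class: translations × `D₄` with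
the gauge quarter turn on the `b₁g`-odd elements, `twistedSpaceGroupUnitary S`, any `S ∋` anything) carries the
charged eom term `Re ω̄^{tw}_ζ(K_L Γ_L X − Γ_L X K_L)`, `K_L = H_L − μ'N̂`. By PairLROTowerChargedTwist this is the
plain charged eom term of the translation sum of the symmetrised GAUGE-CONJUGATED word
`X^{tw}_S = (2|S|)⁻¹ Σ_{γ∈S} Σ_m Γ(incl)Γ(d4Emb γ) 𝒢_{j(γ)+2m} X 𝒢ᴴ_{j(γ)+2m} ∈ 𝔄_Ω` — even with even adjoint, with
operator-norm charge `≤ ‖N̂_{Λ'}X − XN̂_{Λ'}‖` — so the grid theorem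
`liminf_pairFieldLRO_le_sq_of_onePoint_chargedStationary_bound_TT'_near` applies verbatim:

* **`liminf_pairFieldLRO_le_sq_of_onePoint_chargedStationary_twisted_orbitState_bound_TT'_near`** — for EVERY
  nonempty `S ⊆ D₄` (no `b1gSign` hypothesis; the `d`-wave form factor), cell datum `μ_c ∈ [μ₋(n), μ₊(n)]`,
  `|μ' − μ_c| ≤ Δ`, local charge bound `‖N̂_{Λ'}X − XN̂_{Λ'}‖ ≤ C_q` ⇒ `liminf_k u_k ≤ (c − Δ·C_q − A + (Σμ_σ)(n/2 − ν))²`;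
* **`ObsPairLROCeilingAt_of_onePoint_charged_twisted_orbitState_bound_sq`** (+ `_reprice`) — the registry
  consumer at any anchor `(U, n, t′)`, `0 < n < 2`, cap `e₀ ≤ hi ≤ u`.

CONDITIONAL on the claim node and the cell datum fed in; a ceiling never speaks to presence.
References: T. Koma, H. Tasaki, J. Stat. Phys. 76 (1994) 745, Theorem 5 [KomaTasaki1994]; O. Bratteli,
D. W. Robinson, *Operator Algebras and Quantum Statistical Mechanics 2* (1997) §5.2.2, §6.2.4
[BratteliRobinsonII1997]; W. Pusz, S. L. Woronowicz, Comm. Math. Phys. 58 (1978) 273, §1 [PuszWoronowicz1978];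
D. Ruelle, *Statistical Mechanics* (1969) §3.4 [Ruelle1969].
-/

noncomputable section

namespace Summit.Ventures.CertifiedManyBodySolver.Observables

open Matrix Complex Finset Literature.MathematicalPhysics.QuantumLattice Literature.Probability.LatticeModels
open Literature.MathematicalPhysics.QuantumLattice.HubbardWave0 ThermodynamicLimit Filter Topology
open Literature.MathematicalPhysics.QuantumManyBody.StateRelaxation
open Summit.Ventures.CertifiedManyBodySolver.Transport
open scoped ComplexOrder ComplexConjugate BigOperators Matrix.Norms.L2Operator

/-! ### §1  The symmetrised gauge-conjugated word: evenness, adjoint, charge -/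

section Symmetrised

variable {Λ' Ω : Finset (Site 2)} (S : Finset (DihedralGroup 4))

/-- **The symmetrised gauge-conjugated word is even** when `X` is. [cite: BratteliRobinsonII1997, §5.2.2] -/
theorem twistedSpaceGroupAverage_mem_carEvenSubalgebra (hsub : ∀ γ ∈ S, d4ShiftSet γ 0 Λ' ⊆ Ω) {X : FermionOp Λ'}
    (hX : X ∈ carEvenSubalgebra (Finset.univ : Finset (Orb (PolySite Λ')))) (a : ℂ) :
    (a • ∑ γ ∈ S.attach, ∑ m : Fin 2, fermionEmbed (PolySite.incl (hsub γ.1 γ.2))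
        (fermionEmbed (PolySite.d4Emb γ.1 0 Λ') (fockGauge (twistExp γ.1 m) * X * (fockGauge (twistExp γ.1 m))ᴴ)) :
        FermionOp Ω) ∈ carEvenSubalgebra (Finset.univ : Finset (Orb (PolySite Ω))) := by
  refine Subalgebra.smul_mem _ (Subalgebra.sum_mem _ fun γ _ => Subalgebra.sum_mem _ fun m _ => ?_) _
  exact carEvenSubalgebra_mono (Finset.subset_univ _) (fermionEmbed_mem_carEvenSubalgebra _
    (carEvenSubalgebra_mono (Finset.subset_univ _) (fermionEmbed_mem_carEvenSubalgebra _
      (fockGauge_conj_mem_carEvenSubalgebra hX _))))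

/-- The adjoint of the symmetrised gauge-conjugated word is the symmetrised gauge-conjugated adjoint. [folklore] -/
theorem conjTranspose_twistedSpaceGroupAverage (hsub : ∀ γ ∈ S, d4ShiftSet γ 0 Λ' ⊆ Ω) (X : FermionOp Λ') (a : ℂ) :
    (a • ∑ γ ∈ S.attach, ∑ m : Fin 2, fermionEmbed (PolySite.incl (hsub γ.1 γ.2))
        (fermionEmbed (PolySite.d4Emb γ.1 0 Λ') (fockGauge (twistExp γ.1 m) * X * (fockGauge (twistExp γ.1 m))ᴴ)) :
        FermionOp Ω)ᴴ =
      star a • ∑ γ ∈ S.attach, ∑ m : Fin 2, fermionEmbed (PolySite.incl (hsub γ.1 γ.2))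
        (fermionEmbed (PolySite.d4Emb γ.1 0 Λ') (fockGauge (twistExp γ.1 m) * Xᴴ * (fockGauge (twistExp γ.1 m))ᴴ)) := by
  rw [conjTranspose_smul, conjTranspose_sum]
  refine congrArg _ (Finset.sum_congr rfl fun γ _ => ?_)
  rw [conjTranspose_sum]
  refine Finset.sum_congr rfl fun m _ => ?_
  rw [← fermionEmbed_conjTranspose, ← fermionEmbed_conjTranspose, conjTranspose_fockGauge_conj]

/-- **The operator-norm charge of the symmetrised gauge-conjugated word is at most that of `X`.**
[cite: BratteliRobinsonII1997, §5.2.2] -/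
theorem norm_totalNumberOp_commutator_twistedSpaceGroupAverage_le (hS : S.Nonempty)
    (hsub : ∀ γ ∈ S, d4ShiftSet γ 0 Λ' ⊆ Ω) (X : FermionOp Λ') :
    ‖(totalNumberOp : FermionOp Ω) *
        ((((S.card : ℂ) * 2))⁻¹ • ∑ γ ∈ S.attach, ∑ m : Fin 2, fermionEmbed (PolySite.incl (hsub γ.1 γ.2))
          (fermionEmbed (PolySite.d4Emb γ.1 0 Λ') (fockGauge (twistExp γ.1 m) * X * (fockGauge (twistExp γ.1 m))ᴴ))) -
      ((((S.card : ℂ) * 2))⁻¹ • ∑ γ ∈ S.attach, ∑ m : Fin 2, fermionEmbed (PolySite.incl (hsub γ.1 γ.2))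
          (fermionEmbed (PolySite.d4Emb γ.1 0 Λ') (fockGauge (twistExp γ.1 m) * X * (fockGauge (twistExp γ.1 m))ᴴ))) *
        totalNumberOp‖ ≤
      ‖(totalNumberOp : FermionOp Λ') * X - X * totalNumberOp‖ := by
  have hcardpos : (0 : ℝ) < (S.card : ℝ) * 2 := by
    have : (0 : ℝ) < (S.card : ℝ) := Nat.cast_pos.2 (Finset.card_pos.2 hS)
    positivity
  set C : FermionOp Λ' := (totalNumberOp : FermionOp Λ') * X - X * totalNumberOp with hC
  have hcomm : (totalNumberOp : FermionOp Ω) *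
        ((((S.card : ℂ) * 2))⁻¹ • ∑ γ ∈ S.attach, ∑ m : Fin 2, fermionEmbed (PolySite.incl (hsub γ.1 γ.2))
          (fermionEmbed (PolySite.d4Emb γ.1 0 Λ') (fockGauge (twistExp γ.1 m) * X * (fockGauge (twistExp γ.1 m))ᴴ))) -
      ((((S.card : ℂ) * 2))⁻¹ • ∑ γ ∈ S.attach, ∑ m : Fin 2, fermionEmbed (PolySite.incl (hsub γ.1 γ.2))
          (fermionEmbed (PolySite.d4Emb γ.1 0 Λ') (fockGauge (twistExp γ.1 m) * X * (fockGauge (twistExp γ.1 m))ᴴ))) *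
        totalNumberOp =
      (((S.card : ℂ) * 2))⁻¹ • ∑ γ ∈ S.attach, ∑ m : Fin 2, fermionEmbed (PolySite.incl (hsub γ.1 γ.2))
        (fermionEmbed (PolySite.d4Emb γ.1 0 Λ')
          (totalNumberOp * (fockGauge (twistExp γ.1 m) * X * (fockGauge (twistExp γ.1 m))ᴴ) -
            (fockGauge (twistExp γ.1 m) * X * (fockGauge (twistExp γ.1 m))ᴴ) * totalNumberOp)) := by
    rw [Matrix.mul_smul, Matrix.smul_mul, ← smul_sub, Finset.mul_sum, Finset.sum_mul, ← Finset.sum_sub_distrib]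
    refine congrArg _ (Finset.sum_congr rfl fun γ _ => ?_)
    rw [Finset.mul_sum, Finset.sum_mul, ← Finset.sum_sub_distrib]
    refine Finset.sum_congr rfl fun m _ => ?_
    rw [totalNumberOp_commutator_fermionEmbed, totalNumberOp_commutator_fermionEmbed]
  rw [hcomm, norm_smul, norm_inv, norm_mul, Complex.norm_natCast, Complex.norm_two]
  calc ((S.card : ℝ) * 2)⁻¹ * ‖∑ γ ∈ S.attach, ∑ m : Fin 2, fermionEmbed (PolySite.incl (hsub γ.1 γ.2))
        (fermionEmbed (PolySite.d4Emb γ.1 0 Λ')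
          (totalNumberOp * (fockGauge (twistExp γ.1 m) * X * (fockGauge (twistExp γ.1 m))ᴴ) -
            (fockGauge (twistExp γ.1 m) * X * (fockGauge (twistExp γ.1 m))ᴴ) * totalNumberOp))‖
      ≤ ((S.card : ℝ) * 2)⁻¹ * ∑ _γ ∈ S.attach, ∑ _m : Fin 2, ‖C‖ := by
        refine mul_le_mul_of_nonneg_left ((norm_sum_le _ _).trans (Finset.sum_le_sum fun γ _ =>
          (norm_sum_le _ _).trans (Finset.sum_le_sum fun m _ => ?_))) (inv_nonneg.2 hcardpos.le)
        exact (norm_fermionEmbed_le _ _).trans ((norm_fermionEmbed_le _ _).trans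
          (norm_totalNumberOp_commutator_fockGauge_conj_le _ X))
    _ = ‖C‖ := by
        rw [Finset.sum_const, Finset.card_attach, Finset.sum_const, Finset.card_univ, Fintype.card_fin, smul_smul,
          nsmul_eq_mul, Nat.cast_mul, Nat.cast_two, ← mul_assoc, inv_mul_cancel₀ hcardpos.ne', one_mul]

end Symmetrised

/-! ### §2  (OP1-C) in TWISTED orbit-state form at a grid point ⇒ `liminf u_k ≤ (M + Δ·C_q)²` -/

section Family

/-- **Twisted orbit-state form of OP1-C at a grid chemical potential, sharp constant, `d`-wave form factor.**
As `liminf_pairFieldLRO_le_sq_of_onePoint_chargedStationary_orbitState_bound_TT'_near` (PairLROTowerChargedReading)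
but with the TWISTED orbit state `orbitState (twistedSpaceGroupUnitary S)` in the node — both in the charged eom
term `Re ω̄^{tw}_ζ(K_L Γ_L X − Γ_L X K_L)`, `K_L = H_L − μ'N̂`, and in the objective `Re ω̄^{tw}_ζ(Γ_L(−Γ(incl)Φ₀))` —
and NO `b1gSign` hypothesis on `S ≠ ∅` (the gauge twist cancels the `B₁g` sign,
`re_orbitState_twistedSpaceGroupUnitary_localPairAt`). Conclusion:
`liminf_k u_k ≤ (c − Δ·C_q − A + (Σ_σ μ_σ)(n/2 − ν))²`.
[cite: KomaTasaki1994, Theorem 5] [cite: PuszWoronowicz1978, §1] [cite: BratteliRobinsonII1997, §6.2.4]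
[cite: Ruelle1969, §3.4] -/
theorem liminf_pairFieldLRO_le_sq_of_onePoint_chargedStationary_twisted_orbitState_bound_TT'_near (t t' : ℝ)
    {U n : ℝ} (hU : 0 ≤ U) (hn0 : 0 < n) (hn2 : n < 2) {c A κ u ν : ℝ} (μ : Fin 2 → ℝ) (hκ : 0 ≤ κ)
    (hu : energyDensityTT' t t' U n ≤ u) {μc μ' Δ Cq : ℝ}
    (hμc : μc ∈ Set.Icc (chemPotMinusTT' t t' U n) (chemPotPlusTT' t t' U n)) (hnear : |μ' - μc| ≤ Δ)
    {S : Finset (DihedralGroup 4)} (hS : S.Nonempty)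
    {Λ' : Finset (Site 2)} (h0 : pairRegion (insert (0 : Site 2) unitSteps) 0 ⊆ Λ')
    (X : FermionOp Λ') (hXeven : X ∈ carEvenSubalgebra (Finset.univ : Finset (Orb (PolySite Λ'))))
    (hXevenH : Xᴴ ∈ carEvenSubalgebra (Finset.univ : Finset (Orb (PolySite Λ'))))
    (hXq : ‖(totalNumberOp : FermionOp Λ') * X - X * totalNumberOp‖ ≤ Cq) (L₁ : ℕ)
    (hInj : ∀ L : ℕ, L₁ ≤ L → Set.InjOn (Torus.proj (d := 2) L) ↑Λ')
    (hbound : ∀ (L : ℕ) [NeZero L] (hL : L₁ ≤ L) (ζ : Fock (Orb (FermionTorus 2 L))), star ζ ⬝ᵥ ζ = 1 →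
      c - A + ∑ σ : Fin 2, μ σ *
          ((star ζ ⬝ᵥ ((∑ y : FermionTorus 2 L, numberOp y σ) *ᵥ ζ)).re / (L : ℝ) ^ 2 - ν) +
        κ * (u - (star ζ ⬝ᵥ (hubbardTorusTT' L t t' U *ᵥ ζ)).re / (L : ℝ) ^ 2) +
        (orbitState (twistedSpaceGroupUnitary S) ζ
          ((hubbardTorusTT' L t t' U - (μ' : ℂ) • totalNumber) * fermionEmbed (PolySite.toTorusEmb L (hInj L hL)) X -
            fermionEmbed (PolySite.toTorusEmb L (hInj L hL)) X *
              (hubbardTorusTT' L t t' U - (μ' : ℂ) • totalNumber))).re ≤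
        (orbitState (twistedSpaceGroupUnitary S) ζ (fermionEmbed (PolySite.toTorusEmb L (hInj L hL))
          (-(fermionEmbed (PolySite.incl h0) (localPairAt (insert (0 : Site 2) unitSteps) dWaveFormFactor 0))))).re)
    (ψ : ∀ L, Fock (Orb (FermionTorus 2 L)))
    (hψ : ∀ L, IsGroundStateInSector (hubbardTorusTT' L t t' U) (rectN n L) 0 (ψ L))
    (hψ1 : ∀ L, star (ψ L) ⬝ᵥ ψ L = 1) :
    liminf (fun k : ℕ => (∑ x ∈ halfOpenBox 2 (2 * k), ∑ y ∈ halfOpenBox 2 (2 * k),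
        torusPullback (pairFieldCorr dWaveFormFactor ψ) (2 * k) x y) / ((#(halfOpenBox 2 (2 * k)) : ℝ)) ^ 2) atTop ≤
      (c - Δ * Cq - A + (∑ σ : Fin 2, μ σ) * (n / 2 - ν)) ^ 2 := by
  -- the symmetrised gauge-conjugated eom word on `Ω = ⋃_γ γΛ'`
  set Ω : Finset (Site 2) := S.biUnion (fun γ => d4ShiftSet γ 0 Λ') with hΩdef
  have hsub : ∀ γ ∈ S, d4ShiftSet γ 0 Λ' ⊆ Ω := fun γ hγ =>
    Finset.subset_biUnion_of_mem (fun γ => d4ShiftSet γ 0 Λ') hγ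
  set XS : FermionOp Ω := (((S.card : ℂ) * 2))⁻¹ •
    ∑ γ ∈ S.attach, ∑ m : Fin 2, fermionEmbed (PolySite.incl (hsub γ.1 γ.2))
      (fermionEmbed (PolySite.d4Emb γ.1 0 Λ') (fockGauge (twistExp γ.1 m) * X * (fockGauge (twistExp γ.1 m))ᴴ))
    with hXS
  have hXSeven : XS ∈ carEvenSubalgebra (Finset.univ : Finset (Orb (PolySite Ω))) :=
    twistedSpaceGroupAverage_mem_carEvenSubalgebra S hsub hXeven _
  have hXSevenH : XSᴴ ∈ carEvenSubalgebra (Finset.univ : Finset (Orb (PolySite Ω))) := by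
    rw [hXS, conjTranspose_twistedSpaceGroupAverage S hsub X]
    exact twistedSpaceGroupAverage_mem_carEvenSubalgebra S hsub hXevenH _
  have hXSq : ‖(totalNumberOp : FermionOp Ω) * XS - XS * totalNumberOp‖ ≤ Cq :=
    (norm_totalNumberOp_commutator_twistedSpaceGroupAverage_le S hS hsub X).trans hXq
  obtain ⟨DN, LN, hDN, hDD₁, hDD₂⟩ := exists_abs_re_doubleCommutator_totalNumber_le_hermitianParts XS hXSeven hXSevenH
  obtain ⟨LΩ, hLΩ⟩ := exists_forall_le_injOn_proj (d := 2) Ω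
  have hInjΩ : ∀ L : ℕ, max L₁ LΩ ≤ L → Set.InjOn (Torus.proj (d := 2) L) ↑Ω :=
    fun L hL => hLΩ L (le_trans (le_max_right _ _) hL)
  refine liminf_pairFieldLRO_le_sq_of_onePoint_chargedStationary_bound_TT'_near dWaveFormFactor t t' hU hn0 hn2 μ
    hκ hu hμc hnear XS hXSeven hXSevenH (max L₁ LΩ) hInjΩ LN hDN
    (fun L _ hL hLN χ hχ => hDD₁ L hLN (hInjΩ L hL) χ hχ)
    (fun L _ hL hLN χ hχ => hDD₂ L hLN (hInjΩ L hL) χ hχ) ?_ ?_ ψ hψ hψ1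
  · -- `hWq` in operator-norm form
    intro L _ hL ζ hζ
    exact (abs_re_expect_totalNumber_commutator_translationSum_le_opNorm (hInjΩ L hL) XS ζ hζ).trans
      (mul_le_mul_of_nonneg_right hXSq (by positivity))
  · -- the node: the twisted-averaged charged eom term is the plain charged eom term of the translation sum of `XS`
    intro L _ hL ζ hζ
    have hL₁ : L₁ ≤ L := le_trans (le_max_left _ _) hL
    have hcardS : ((S.card : ℂ) * 2) ≠ 0 :=
      mul_ne_zero (Nat.cast_ne_zero.2 (Finset.card_pos.2 hS).ne') two_ne_zero
    have hcardT : (Fintype.card (TorusSite 2 L) : ℂ) = (((L : ℝ) ^ 2 : ℝ) : ℂ) := by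
      have hc : Fintype.card (TorusSite 2 L) = L ^ 2 := by simp [ZMod.card, Fintype.card_fin]
      rw [hc]; push_cast; ring
    set K : Matrix (Finset (Orb (FermionTorus 2 L))) (Finset (Orb (FermionTorus 2 L))) ℂ :=
      hubbardTorusTT' L t t' U - (μ' : ℂ) • totalNumber with hK
    have hKD : ∀ γ : DihedralGroup 4, relabel (Orb.d4Perm (L := L) γ) K = K := fun γ =>
      relabel_d4Perm_hubbardTorusTT'_sub_smul_totalNumber γ t t' U _
    have hKT : ∀ v : TorusSite 2 L, relabel (Orb.translate v) K = K := fun v =>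
      relabel_translate_hubbardTorusTT'_sub_smul_totalNumber v t t' U _
    have hKN : Commute totalNumberOp K := by
      rw [hK, totalNumberOp_eq_totalNumber]
      exact ((hubbardTorusTT'_commute_totalNumber L t t' U).symm).sub_right ((Commute.refl _).smul_right _)
    have hW : ∑ v : TorusSite 2 L, relabel (Orb.translate v) (fermionEmbed (PolySite.toTorusEmb L (hInjΩ L hL)) XS) =
        (((S.card : ℂ) * 2))⁻¹ • ∑ γ ∈ S, ∑ m : Fin 2, (∑ v : TorusSite 2 L, relabel (Orb.translate v)
          (fermionEmbed (PolySite.toTorusEmb L ((injOn_proj_d4ShiftSet_iff L γ 0 Λ').2 (hInj L hL₁)))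
            (fermionEmbed (PolySite.d4Emb γ 0 Λ')
              (fockGauge (twistExp γ m) * X * (fockGauge (twistExp γ m))ᴴ)))) := by
      rw [sum_translate_twistedSpaceGroupAverage_eq S (hInj L hL₁) (hInjΩ L hL) hsub X, hXS]
      simp_rw [fermionEmbed_smul, relabel_smul]
      rw [← Finset.smul_sum]
    have hsumexp : ∑ γ ∈ S, ∑ m : Fin 2, expect (K *
        (∑ v : TorusSite 2 L, relabel (Orb.translate v)
          (fermionEmbed (PolySite.toTorusEmb L ((injOn_proj_d4ShiftSet_iff L γ 0 Λ').2 (hInj L hL₁)))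
            (fermionEmbed (PolySite.d4Emb γ 0 Λ')
              (fockGauge (twistExp γ m) * X * (fockGauge (twistExp γ m))ᴴ)))) -
        (∑ v : TorusSite 2 L, relabel (Orb.translate v)
          (fermionEmbed (PolySite.toTorusEmb L ((injOn_proj_d4ShiftSet_iff L γ 0 Λ').2 (hInj L hL₁)))
            (fermionEmbed (PolySite.d4Emb γ 0 Λ')
              (fockGauge (twistExp γ m) * X * (fockGauge (twistExp γ m))ᴴ)))) * K) ζ =
        ((S.card : ℂ) * 2) * expect (K *
          (∑ v : TorusSite 2 L, relabel (Orb.translate v) (fermionEmbed (PolySite.toTorusEmb L (hInjΩ L hL)) XS)) -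
          (∑ v : TorusSite 2 L, relabel (Orb.translate v) (fermionEmbed (PolySite.toTorusEmb L (hInjΩ L hL)) XS)) *
            K) ζ := by
      rw [hW, Matrix.mul_smul, Matrix.smul_mul, ← smul_sub, Finset.mul_sum, Finset.sum_mul, ← Finset.sum_sub_distrib]
      unfold Literature.MathematicalPhysics.QuantumLattice.expect
      rw [smul_mulVec, dotProduct_smul, smul_eq_mul, ← mul_assoc, mul_inv_cancel₀ hcardS, one_mul,
        Matrix.sum_mulVec, dotProduct_sum]
      refine Finset.sum_congr rfl fun γ _ => ?_
      rw [Finset.mul_sum, Finset.sum_mul, ← Finset.sum_sub_distrib, Matrix.sum_mulVec, dotProduct_sum]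
    have heom : (orbitState (twistedSpaceGroupUnitary S) ζ
        (K * fermionEmbed (PolySite.toTorusEmb L (hInj L hL₁)) X -
          fermionEmbed (PolySite.toTorusEmb L (hInj L hL₁)) X * K)).re =
        (star ζ ⬝ᵥ ((K *
          (∑ v : TorusSite 2 L, relabel (Orb.translate v) (fermionEmbed (PolySite.toTorusEmb L (hInjΩ L hL)) XS)) -
          (∑ v : TorusSite 2 L, relabel (Orb.translate v) (fermionEmbed (PolySite.toTorusEmb L (hInjΩ L hL)) XS)) *
            K) *ᵥ ζ)).re / (L : ℝ) ^ 2 := by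
      rw [orbitState_twistedSpaceGroupUnitary_commutator_fermionEmbed_of_invariant S K hKD hKT hKN (hInj L hL₁) X ζ]
      simp_rw [← Finset.mul_sum]
      rw [hsumexp, mul_left_comm, inv_mul_cancel_left₀ hcardS, hcardT, ← Complex.ofReal_inv,
        Complex.re_ofReal_mul, inv_mul_eq_div]
      rfl
    have h := hbound L hL₁ ζ hζ
    rw [fermionEmbed_neg, map_neg, Complex.neg_re,
      re_orbitState_twistedSpaceGroupUnitary_localPairAt hS h0 (hInj L hL₁) ζ, heom] at h
    exact h

end Family

/-! ### §3  The registry consumer for TWISTED OP1-C nodes at ANY anchor `(U, n, t′)` -/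

section Consumer

variable {tp U n : ℝ} {hi c' : ℚ} {c A κ u ν μc μ' Δ Cq : ℝ}

/-- **Twisted OP1-C orbit-state node at `(U, n, t′)` ⇒ the pair-LRO ceiling leaf at `(M + Δ·C_q)²`.** As
`ObsPairLROCeilingAt_of_onePoint_charged_orbitState_bound_sq` (PairLROTowerChargedLeaf) but with the TWISTED orbit
state `orbitState (twistedSpaceGroupUnitary S)` in the node inequality and NO `b1gSign` hypothesis on `S ≠ ∅`.
CONDITIONAL ON THE CLAIM NODE and the cell datum. [cite: KomaTasaki1994, Theorem 5] [cite: Ruelle1969, §3.4] -/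
theorem ObsPairLROCeilingAt_of_onePoint_charged_twisted_orbitState_bound_sq (hU : 0 ≤ U) (hn0 : 0 < n)
    (hn2 : n < 2) (μ : Fin 2 → ℝ) (hκ : 0 ≤ κ) (hE : energyDensityTT' 1 tp U n ≤ ((hi : ℚ) : ℝ))
    (hhi : ((hi : ℚ) : ℝ) ≤ u)
    (hμc : μc ∈ Set.Icc (chemPotMinusTT' 1 tp U n) (chemPotPlusTT' 1 tp U n)) (hnear : |μ' - μc| ≤ Δ)
    {S : Finset (DihedralGroup 4)} (hS : S.Nonempty)
    {Λ' : Finset (Site 2)} (h0 : pairRegion (insert (0 : Site 2) unitSteps) 0 ⊆ Λ')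
    (X : FermionOp Λ') (hXeven : X ∈ carEvenSubalgebra (Finset.univ : Finset (Orb (PolySite Λ'))))
    (hXevenH : Xᴴ ∈ carEvenSubalgebra (Finset.univ : Finset (Orb (PolySite Λ'))))
    (hXq : ‖(totalNumberOp : FermionOp Λ') * X - X * totalNumberOp‖ ≤ Cq) (L₁ : ℕ)
    (hInj : ∀ L : ℕ, L₁ ≤ L → Set.InjOn (Torus.proj (d := 2) L) ↑Λ')
    (hbound : ∀ (L : ℕ) [NeZero L] (hL : L₁ ≤ L) (ζ : Fock (Orb (FermionTorus 2 L))), star ζ ⬝ᵥ ζ = 1 →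
      c - A + ∑ σ : Fin 2, μ σ *
          ((star ζ ⬝ᵥ ((∑ y : FermionTorus 2 L, numberOp y σ) *ᵥ ζ)).re / (L : ℝ) ^ 2 - ν) +
        κ * (u - (star ζ ⬝ᵥ (hubbardTorusTT' L 1 tp U *ᵥ ζ)).re / (L : ℝ) ^ 2) +
        (orbitState (twistedSpaceGroupUnitary S) ζ
          ((hubbardTorusTT' L 1 tp U - (μ' : ℂ) • totalNumber) * fermionEmbed (PolySite.toTorusEmb L (hInj L hL)) X -
            fermionEmbed (PolySite.toTorusEmb L (hInj L hL)) X *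
              (hubbardTorusTT' L 1 tp U - (μ' : ℂ) • totalNumber))).re ≤
        (orbitState (twistedSpaceGroupUnitary S) ζ (fermionEmbed (PolySite.toTorusEmb L (hInj L hL))
          (-(fermionEmbed (PolySite.incl h0)
            (localPairAt (insert (0 : Site 2) unitSteps) dWaveFormFactor 0))))).re)
    (hc' : (c - Δ * Cq - A + (∑ σ : Fin 2, μ σ) * (n / 2 - ν)) ^ 2 ≤ ((c' : ℚ) : ℝ)) :
    ObsPairLROCeilingAt tp U n c' := by
  intro ψ hψ hψ1
  exact (liminf_pairFieldLRO_le_sq_of_onePoint_chargedStationary_twisted_orbitState_bound_TT'_near 1 tp hU hn0 hn2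
    μ hκ (hE.trans hhi) hμc hnear hS h0 X hXeven hXevenH hXq L₁ hInj hbound ψ hψ hψ1).trans hc'

/-- **THE ONE-POINT FAST LAYER for twisted OP1-C nodes.** The same node read under ANY certified cap `e₀ ≤ hi`
gives the leaf at every `c' ≥ (c − Δ·C_q − A + (Σμ)(n/2 − ν) + κ(u − hi))²`. [cite: KomaTasaki1994, Theorem 5] -/
theorem ObsPairLROCeilingAt_of_onePoint_charged_twisted_orbitState_bound_sq_reprice (hU : 0 ≤ U) (hn0 : 0 < n)
    (hn2 : n < 2) (μ : Fin 2 → ℝ) (hκ : 0 ≤ κ) (hE : energyDensityTT' 1 tp U n ≤ ((hi : ℚ) : ℝ))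
    (hμc : μc ∈ Set.Icc (chemPotMinusTT' 1 tp U n) (chemPotPlusTT' 1 tp U n)) (hnear : |μ' - μc| ≤ Δ)
    {S : Finset (DihedralGroup 4)} (hS : S.Nonempty)
    {Λ' : Finset (Site 2)} (h0 : pairRegion (insert (0 : Site 2) unitSteps) 0 ⊆ Λ')
    (X : FermionOp Λ') (hXeven : X ∈ carEvenSubalgebra (Finset.univ : Finset (Orb (PolySite Λ'))))
    (hXevenH : Xᴴ ∈ carEvenSubalgebra (Finset.univ : Finset (Orb (PolySite Λ'))))
    (hXq : ‖(totalNumberOp : FermionOp Λ') * X - X * totalNumberOp‖ ≤ Cq) (L₁ : ℕ)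
    (hInj : ∀ L : ℕ, L₁ ≤ L → Set.InjOn (Torus.proj (d := 2) L) ↑Λ')
    (hbound : ∀ (L : ℕ) [NeZero L] (hL : L₁ ≤ L) (ζ : Fock (Orb (FermionTorus 2 L))), star ζ ⬝ᵥ ζ = 1 →
      c - A + ∑ σ : Fin 2, μ σ *
          ((star ζ ⬝ᵥ ((∑ y : FermionTorus 2 L, numberOp y σ) *ᵥ ζ)).re / (L : ℝ) ^ 2 - ν) +
        κ * (u - (star ζ ⬝ᵥ (hubbardTorusTT' L 1 tp U *ᵥ ζ)).re / (L : ℝ) ^ 2) +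
        (orbitState (twistedSpaceGroupUnitary S) ζ
          ((hubbardTorusTT' L 1 tp U - (μ' : ℂ) • totalNumber) * fermionEmbed (PolySite.toTorusEmb L (hInj L hL)) X -
            fermionEmbed (PolySite.toTorusEmb L (hInj L hL)) X *
              (hubbardTorusTT' L 1 tp U - (μ' : ℂ) • totalNumber))).re ≤
        (orbitState (twistedSpaceGroupUnitary S) ζ (fermionEmbed (PolySite.toTorusEmb L (hInj L hL))
          (-(fermionEmbed (PolySite.incl h0)
            (localPairAt (insert (0 : Site 2) unitSteps) dWaveFormFactor 0))))).re)
    (hc' : (c - Δ * Cq - A + (∑ σ : Fin 2, μ σ) * (n / 2 - ν) + κ * (u - ((hi : ℚ) : ℝ))) ^ 2 ≤ ((c' : ℚ) : ℝ)) :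
    ObsPairLROCeilingAt tp U n c' := by
  have hc'' : (c + κ * (u - ((hi : ℚ) : ℝ)) - Δ * Cq - A + (∑ σ : Fin 2, μ σ) * (n / 2 - ν)) ^ 2 ≤
      ((c' : ℚ) : ℝ) := by
    have : c + κ * (u - ((hi : ℚ) : ℝ)) - Δ * Cq - A + (∑ σ : Fin 2, μ σ) * (n / 2 - ν) =
        c - Δ * Cq - A + (∑ σ : Fin 2, μ σ) * (n / 2 - ν) + κ * (u - ((hi : ℚ) : ℝ)) := by ring
    rw [this]; exact hc'
  refine ObsPairLROCeilingAt_of_onePoint_charged_twisted_orbitState_bound_sq (c := c + κ * (u - ((hi : ℚ) : ℝ)))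
    (u := ((hi : ℚ) : ℝ)) hU hn0 hn2 μ hκ hE le_rfl hμc hnear hS h0 X hXeven hXevenH hXq L₁ hInj ?_ hc''
  intro L _ hL ζ hζ
  convert hbound L hL ζ hζ using 1
  ring

end Consumer

end Summit.Ventures.CertifiedManyBodySolver.Observables

end
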